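import Mathlib
import HarnessLib

/-!
# Crux K2 `PoloidalWindowRigidity` (stmt-NavierStokesRegularity-19708), line `z_shock` — one-variable tools for R2 without sign
# hypothesis when ONE Riemann invariant is quiet at spatial infinity

`--supports stmt-NavierStokesRegularity-19708 --as helper` (leafhand-ns-poloidalwindowdoor-3 g3, cell decomp-ns, 2026-08-31).  Class-free,
Mathlib only.  **No stub and no summit is closed by this file; Navier–Stokes regularity is NOT proved here (rung 0).**

Tools for `…ZShockQuietInvariant` (the sequel): along a forward characteristic of the autonomous p-system John's weighted gradient
`q = κ(w)^{1/2} r_x` solves the Riccati equation `q' = −b(z) q²` with `b(z) = κ'(w)/(2κ(w)^{3/2})` evaluated along the curve; when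
the backward invariant is quiet at spatial infinity, `b(z)` has the SAME limit at `z → +∞` and `z → −∞`.

* `slope_ge_of_deriv_ge` — mean-value inequality on an interval from a pointwise lower bound on the derivative.
* `exists_zero_of_eventually_signed_deriv` — a differentiable `ψ` with `ψ' ≥ b₀ > 0` on a right half-line AND on a left half-line
  has a zero (it tends to `+∞` forward and `−∞` backward).
* `riccati_no_twoSided_of_eventually_pos` / `…_neg` — ★ a never-vanishing two-sided solution of `q' = −b q²` cannot have `b ≥ b₀ > 0`
  (resp. `b ≤ −b₀ < 0`) on both a right and a left half-line: `1/q` has derivative `b` and would vanish.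
* `exists_lim_of_tendsto_strictMono` — if `K` is continuous and strictly increasing, `f` is bounded and `K ∘ f → L` along a filter,
  then `f → v` for some `v` with `K v = L` (the value `v = K⁻¹(L)` without inverting `K`).
[folklore]
-/

noncomputable section

namespace Summit.NavierStokesRegularity.NavierStokesRegularity.Theorems.PoloidalWindowDoorPoloidalWindowRigidityZShockQuietTools

-- the summit and its single sub-problem share the name (CONVENTIONS §1)
set_option linter.dupNamespace false

open Set Filter Topology Function Metric

/-- Mean-value inequality: `ψ' ≥ b₀` on `(a, b)` gives `b₀ (b − a) ≤ ψ b − ψ a`. [folklore] -/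
theorem slope_ge_of_deriv_ge {ψ β : ℝ → ℝ} {b₀ a b : ℝ} (hψ : ∀ z, HasDerivAt ψ (β z) z) (hab : a < b)
    (hβ : ∀ z ∈ Ioo a b, b₀ ≤ β z) : b₀ * (b - a) ≤ ψ b - ψ a := by
  have hcont : Continuous ψ := continuous_iff_continuousAt.2 fun z => (hψ z).continuousAt
  obtain ⟨c, hc, hcd⟩ := exists_hasDerivAt_eq_slope ψ β hab hcont.continuousOn (fun z _ => hψ z)
  have h := hβ c hc
  rw [hcd, le_div_iff₀ (sub_pos.2 hab)] at h
  exact h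

/-- **A function with derivative `≥ b₀ > 0` on `[T, ∞)` and on `(−∞, S]` has a zero.** [folklore] -/
theorem exists_zero_of_eventually_signed_deriv {ψ β : ℝ → ℝ} {b₀ T S : ℝ} (hψ : ∀ z, HasDerivAt ψ (β z) z)
    (hb₀ : 0 < b₀) (hfwd : ∀ z, T ≤ z → b₀ ≤ β z) (hbwd : ∀ z, z ≤ S → b₀ ≤ β z) : ∃ z, ψ z = 0 := by
  have hcont : Continuous ψ := continuous_iff_continuousAt.2 fun z => (hψ z).continuousAt
  -- a positive value ahead of `T`
  set zp : ℝ := T + (|ψ T| + 1) / b₀ with hzp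
  have hT : T < zp := by
    have : 0 < (|ψ T| + 1) / b₀ := by positivity
    rw [hzp]; linarith
  have hpos : 0 < ψ zp := by
    have h := slope_ge_of_deriv_ge hψ hT (fun z hz => hfwd z hz.1.le)
    have h2 : b₀ * (zp - T) = |ψ T| + 1 := by rw [hzp]; field_simp; ring
    linarith [neg_abs_le (ψ T)]
  -- a negative value behind `S`
  set zm : ℝ := S - (|ψ S| + 1) / b₀ with hzm
  have hS : zm < S := by
    have : 0 < (|ψ S| + 1) / b₀ := by positivity
    rw [hzm]; linarith
  have hneg : ψ zm < 0 := by
    have h := slope_ge_of_deriv_ge hψ hS (fun z hz => hbwd z hz.2.le)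
    have h2 : b₀ * (S - zm) = |ψ S| + 1 := by rw [hzm]; field_simp; ring
    linarith [le_abs_self (ψ S)]
  obtain ⟨c, -, hc0⟩ := intermediate_value_uIcc hcont.continuousOn (mem_uIcc.2 (Or.inl ⟨hneg.le, hpos.le⟩))
  exact ⟨c, hc0⟩

/-- **★ No never-vanishing two-sided Riccati solution with an eventually positive coefficient at both ends.**  If `q' = −b q²` on
`ℝ`, `q` never vanishes, and `b ≥ b₀ > 0` on `[T, ∞)` and on `(−∞, S]`, contradiction: `1/q` has derivative `b`. [folklore] -/
theorem riccati_no_twoSided_of_eventually_pos {q b : ℝ → ℝ} {b₀ T S : ℝ}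
    (hq : ∀ z, HasDerivAt q (-(b z * q z ^ 2)) z) (hne : ∀ z, q z ≠ 0) (hb₀ : 0 < b₀)
    (hfwd : ∀ z, T ≤ z → b₀ ≤ b z) (hbwd : ∀ z, z ≤ S → b₀ ≤ b z) : False := by
  have hψ : ∀ z, HasDerivAt (fun y => (q y)⁻¹) (b z) z := by
    intro z
    have hz := hne z
    have h := (hq z).inv hz
    refine h.congr_deriv ?_
    field_simp
  obtain ⟨z, hz⟩ := exists_zero_of_eventually_signed_deriv hψ hb₀ hfwd hbwd
  exact hne z (inv_eq_zero.1 hz)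

/-- Sign twin: `b ≤ −b₀ < 0` on both half-lines is impossible too (`−q` solves the law with coefficient `−b`). [folklore] -/
theorem riccati_no_twoSided_of_eventually_neg {q b : ℝ → ℝ} {b₀ T S : ℝ}
    (hq : ∀ z, HasDerivAt q (-(b z * q z ^ 2)) z) (hne : ∀ z, q z ≠ 0) (hb₀ : 0 < b₀)
    (hfwd : ∀ z, T ≤ z → b z ≤ -b₀) (hbwd : ∀ z, z ≤ S → b z ≤ -b₀) : False := by
  have hQ : ∀ z, HasDerivAt (fun z => -q z) (-((-b z) * (-q z) ^ 2)) z := fun z =>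
    (hq z).neg.congr_deriv (by ring)
  exact riccati_no_twoSided_of_eventually_pos (q := fun z => -q z) (b := fun z => -b z) hQ
    (fun z => neg_ne_zero.2 (hne z)) hb₀ (fun z hz => by linarith [hfwd z hz]) (fun z hz => by linarith [hbwd z hz])

/-- **Limits through a strictly increasing continuous function.**  If `K` is continuous and strictly increasing, `|f| ≤ M`, and
`K ∘ f → L` along a non-trivial filter, then there is `v` with `K v = L` and `f → v`. [folklore] -/
theorem exists_lim_of_tendsto_strictMono {K f : ℝ → ℝ} {M L : ℝ} {l : Filter ℝ} [l.NeBot] (hK : Continuous K)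
    (hmono : StrictMono K) (hf : ∀ z, |f z| ≤ M) (hlim : Tendsto (fun z => K (f z)) l (𝓝 L)) :
    ∃ v : ℝ, K v = L ∧ Tendsto f l (𝓝 v) := by
  have hM : 0 ≤ M := (abs_nonneg _).trans (hf 0)
  have hMM : -M ≤ M := by linarith
  -- `L ∈ [K(−M), K(M)]`
  have hmem : L ∈ Icc (K (-M)) (K M) := by
    refine isClosed_Icc.mem_of_tendsto hlim (Eventually.of_forall fun z => ?_)
    have h := hf z
    rw [abs_le] at h
    exact ⟨hmono.monotone h.1, hmono.monotone h.2⟩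
  obtain ⟨v, -, hv⟩ := intermediate_value_Icc hMM hK.continuousOn hmem
  refine ⟨v, hv, ?_⟩
  rw [tendsto_order]
  constructor
  · intro a ha
    have h1 : K a < L := hv ▸ hmono ha
    filter_upwards [(tendsto_order.1 hlim).1 _ h1] with z hz
    exact hmono.lt_iff_lt.1 hz
  · intro a ha
    have h1 : L < K a := hv ▸ hmono ha
    filter_upwards [(tendsto_order.1 hlim).2 _ h1] with z hz
    exact hmono.lt_iff_lt.1 hz

end Summit.NavierStokesRegularity.NavierStokesRegularity.Theorems.PoloidalWindowDoorPoloidalWindowRigidityZShockQuietTools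

end
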